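import Summits.RiemannHypothesis.RiemannHypothesis.Theorems.LiTailLaguerreBridgeCoffey
import Literature.Analysis.Fourier.VanDerCorput
import Mathlib.Analysis.SpecialFunctions.Complex.Circle
import HarnessLib

/-!
# RiemannHypothesis / LiTailLaguerre — Fejér companion, part 5: the three-term recurrence of `L¹_{n−1}(y)` and its
# discrete WKB model `n^{1/4} e^{i(2√(ny) + π/4)}` (RH-FREE)

RH-FREE [rh-li-eng g6].  Cell `pub/rh-li`, PART K companion `LiCoffeyTermFejer` (STRONG form, `O(n^{−1/4})`).  The weak
Fejér law (`Theorems/LiTailLaguerreFejer.lean`: `liLaguerreOne n y = −c_y n^{1/4} cos(2√(ny) + π/4) + O_y(1)`) is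
upgraded to the sharp `O(n^{−1/4})` WITHOUT a second-order stationary phase, by a DISCRETE LIOUVILLE–GREEN BOOTSTRAP:
`u_n = liLaguerreOne n y = L¹_{n−1}(y)` satisfies the exact three-term recurrence `u_{n+1} + u_{n−1} = (2 − y/n) u_n`
(Szegő (5.1.10), tree `laguerre_three_term`), and the model `z_n = n^{1/4} e^{iφ_n}`, `φ_n = 2√(ny) + π/4`, satisfies it
up to `‖z_{n+1} + z_{n−1} − (2 − y/n) z_n‖ ≤ 2(1 + y + y²) n^{−7/4}` (this file); the quasi-Casoratian
`Z_n = E_n z_{n+1} − E_{n+1} z_n` of the bounded error `E_n = u_n + c_y Re z_n` then has summable increments, which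
forces `E_n = O(n^{−1/4})` (`Theorems/LiTailLaguerreFejerStrong.lean`).

This file: the fourth root `qrt x = √√x` and its algebra; the second-order Taylor brackets
`1 + h/4 − h²/8 ≤ (1+h)^{1/4} ≤ 1 + h/4`, `1 − h/4 − h²/4 ≤ (1−h)^{1/4} ≤ 1 − h/4`,
`|√(1+h) − 1 − h/2 + h²/8| ≤ h³/16`, `|√(1−h) − 1 + h/2 + h²/8| ≤ h³/8` (`0 ≤ h ≤ 1/2`); the cubic Taylor bound
`‖e^{iδ} − (1 + iδ − δ²/2 − iδ³/6)‖ ≤ (5/96)δ⁴` (Mathlib `Complex.exp_bound`); the recurrence `liLaguerreOne_rec`; the model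
`zm y n`, its phase increments `φ_{n±1} − φ_n = ±ω(1 + d_±)` (`ω = √(y/n)`, `|d_+ + h/4| ≤ h²/8`, `|d_− − h/4| ≤ h²/4`),
and the product form of the steps `z_{n±1} = z_n (1±h)^{1/4} e^{±iω(1+d±)}`; the residual bound and the Casoratian window
are in `Theorems/LiTailLaguerreFejerResidual.lean`.  Nothing here bears on the truth of RH.
-/

noncomputable section

-- D-0017: `Summit.<S>.<S>.…` is the designed namespace of a single-problem summit.
set_option linter.dupNamespace false

open Complex

namespace Summit.RiemannHypothesis.RiemannHypothesis.Theorems.LiTheory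

namespace Fejer

/-! ### The fourth root -/

/-- `qrt x = √(√x) = x^{1/4}` (`x ≥ 0`). -/
def qrt (x : ℝ) : ℝ := Real.sqrt (Real.sqrt x)

/-- `qrt x ≥ 0`. -/
theorem qrt_nonneg (x : ℝ) : 0 ≤ qrt x := Real.sqrt_nonneg _

/-- `qrt x > 0` for `x > 0`. -/
theorem qrt_pos {x : ℝ} (hx : 0 < x) : 0 < qrt x := Real.sqrt_pos.2 (Real.sqrt_pos.2 hx)

/-- `(qrt x)⁴ = x` for `x ≥ 0`. -/
theorem qrt_pow_four {x : ℝ} (hx : 0 ≤ x) : qrt x ^ 4 = x := by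
  unfold qrt
  rw [show (4 : ℕ) = 2 * 2 from rfl, pow_mul, Real.sq_sqrt (Real.sqrt_nonneg _), Real.sq_sqrt hx]

/-- `(qrt x)² = √x`. -/
theorem qrt_sq (x : ℝ) : qrt x ^ 2 = Real.sqrt x := by
  unfold qrt; rw [Real.sq_sqrt (Real.sqrt_nonneg _)]

/-- `qrt (x·y) = qrt x · qrt y` for `x ≥ 0`. -/
theorem qrt_mul {x : ℝ} (hx : 0 ≤ x) (y : ℝ) : qrt (x * y) = qrt x * qrt y := by
  unfold qrt; rw [Real.sqrt_mul hx, Real.sqrt_mul (Real.sqrt_nonneg _)]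

/-- `qrt` is monotone. -/
theorem qrt_le_qrt {x y : ℝ} (h : x ≤ y) : qrt x ≤ qrt y :=
  Real.sqrt_le_sqrt (Real.sqrt_le_sqrt h)

/-- `qrt x = x^{1/4}` for `x ≥ 0`. -/
theorem qrt_eq_rpow {x : ℝ} (hx : 0 ≤ x) : qrt x = x ^ (1 / 4 : ℝ) := by
  unfold qrt
  rw [Real.sqrt_eq_rpow, Real.sqrt_eq_rpow, ← Real.rpow_mul hx]
  norm_num

/-- `1 ≤ qrt x` for `1 ≤ x`. -/
theorem one_le_qrt {x : ℝ} (hx : 1 ≤ x) : 1 ≤ qrt x := by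
  have : qrt 1 = 1 := by unfold qrt; simp
  rw [← this]; exact qrt_le_qrt hx

/-- From fourth powers to fourth roots: `a ≥ 0`, `a⁴ ≤ x` ⇒ `a ≤ qrt x`; `x ≤ b⁴`, `b ≥ 0` ⇒ `qrt x ≤ b`. -/
theorem qrt_bounds {a b x : ℝ} (ha : 0 ≤ a) (hb : 0 ≤ b) (hx : 0 ≤ x) (h1 : a ^ 4 ≤ x) (h2 : x ≤ b ^ 4) :
    a ≤ qrt x ∧ qrt x ≤ b := by
  have hq := qrt_pow_four hx
  constructor
  · exact (pow_le_pow_iff_left₀ ha (qrt_nonneg x) (by norm_num : (4 : ℕ) ≠ 0)).1 (by rw [hq]; exact h1)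
  · exact (pow_le_pow_iff_left₀ (qrt_nonneg x) hb (by norm_num : (4 : ℕ) ≠ 0)).1 (by rw [hq]; exact h2)

/-! ### Second-order Taylor brackets for `(1 ± h)^{1/4}` and `√(1 ± h)` -/

/-- `1 + h/4 − h²/8 ≤ (1+h)^{1/4} ≤ 1 + h/4` for `0 ≤ h ≤ 1/2`. -/
theorem qrt_one_add_bounds {h : ℝ} (h0 : 0 ≤ h) (h1 : h ≤ 1 / 2) :
    1 + h / 4 - h ^ 2 / 8 ≤ qrt (1 + h) ∧ qrt (1 + h) ≤ 1 + h / 4 := by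
  refine qrt_bounds (by nlinarith) (by positivity) (by positivity) ?_ ?_
  · nlinarith [sq_nonneg h, mul_nonneg h0 h0, pow_nonneg h0 3, pow_nonneg h0 4, pow_nonneg h0 5,
      pow_nonneg h0 6, pow_nonneg h0 7, pow_nonneg h0 8]
  · nlinarith [sq_nonneg h, pow_nonneg h0 3, pow_nonneg h0 4]

/-- `1 − h/4 − h²/4 ≤ (1−h)^{1/4} ≤ 1 − h/4` for `0 ≤ h ≤ 1/2`. -/
theorem qrt_one_sub_bounds {h : ℝ} (h0 : 0 ≤ h) (h1 : h ≤ 1 / 2) :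
    1 - h / 4 - h ^ 2 / 4 ≤ qrt (1 - h) ∧ qrt (1 - h) ≤ 1 - h / 4 := by
  refine qrt_bounds (by nlinarith) (by linarith) (by linarith) ?_ ?_
  · nlinarith [sq_nonneg h, mul_nonneg h0 h0, pow_nonneg h0 3, pow_nonneg h0 4, pow_nonneg h0 5,
      pow_nonneg h0 6, pow_nonneg h0 7, pow_nonneg h0 8, mul_nonneg (pow_nonneg h0 3) (sub_nonneg.2 h1)]
  · nlinarith [sq_nonneg h, pow_nonneg h0 3, pow_nonneg h0 4, mul_nonneg (sq_nonneg h) (sub_nonneg.2 h1)]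

/-- From squares to square roots. -/
theorem sqrt_bounds {a b x : ℝ} (hb : 0 ≤ b) (h1 : a ^ 2 ≤ x) (h2 : x ≤ b ^ 2) (ha : 0 ≤ a) :
    a ≤ Real.sqrt x ∧ Real.sqrt x ≤ b :=
  ⟨by simpa [Real.sqrt_sq ha] using Real.sqrt_le_sqrt h1, Real.sqrt_le_iff.2 ⟨hb, h2⟩⟩

/-- `1 + h/2 − h²/8 ≤ √(1+h) ≤ 1 + h/2 − h²/8 + h³/16` for `0 ≤ h ≤ 1`. -/
theorem sqrt_one_add_bounds {h : ℝ} (h0 : 0 ≤ h) (h1 : h ≤ 1) :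
    1 + h / 2 - h ^ 2 / 8 ≤ Real.sqrt (1 + h) ∧ Real.sqrt (1 + h) ≤ 1 + h / 2 - h ^ 2 / 8 + h ^ 3 / 16 := by
  refine sqrt_bounds (by nlinarith [pow_nonneg h0 3]) ?_ ?_ (by nlinarith)
  · nlinarith [pow_nonneg h0 3, pow_nonneg h0 4]
  · nlinarith [pow_nonneg h0 3, pow_nonneg h0 4, pow_nonneg h0 5, pow_nonneg h0 6]

/-- `1 − h/2 − h²/8 − h³/8 ≤ √(1−h) ≤ 1 − h/2 − h²/8` for `0 ≤ h ≤ 1/2`. -/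
theorem sqrt_one_sub_bounds {h : ℝ} (h0 : 0 ≤ h) (h1 : h ≤ 1 / 2) :
    1 - h / 2 - h ^ 2 / 8 - h ^ 3 / 8 ≤ Real.sqrt (1 - h) ∧ Real.sqrt (1 - h) ≤ 1 - h / 2 - h ^ 2 / 8 := by
  refine sqrt_bounds (by nlinarith) ?_ ?_ (by nlinarith [pow_nonneg h0 3])
  · nlinarith [pow_nonneg h0 3, pow_nonneg h0 4, pow_nonneg h0 5, pow_nonneg h0 6,
      mul_nonneg (pow_nonneg h0 3) (sub_nonneg.2 h1)]
  · nlinarith [pow_nonneg h0 3, pow_nonneg h0 4]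

/-! ### The cubic Taylor bound for `e^{iδ}` -/

/-- `‖e^{iδ} − (1 + iδ − δ²/2 − iδ³/6)‖ ≤ (5/96) δ⁴` for `|δ| ≤ 1`. -/
theorem norm_cexp_sub_taylor_le {δ : ℝ} (hδ : |δ| ≤ 1) :
    ‖cexp (I * δ) - (1 + I * δ - (δ : ℂ) ^ 2 / 2 - I * (δ : ℂ) ^ 3 / 6)‖ ≤ 5 / 96 * δ ^ 4 := by
  have hx : ‖I * (δ : ℂ)‖ ≤ 1 := by rw [norm_mul, Complex.norm_I, one_mul, Complex.norm_real]; exact hδ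
  have h := Complex.exp_bound hx (show 0 < 4 by norm_num)
  have hsum : ∑ m ∈ Finset.range 4, (I * (δ : ℂ)) ^ m / (m.factorial : ℂ)
      = 1 + I * δ - (δ : ℂ) ^ 2 / 2 - I * (δ : ℂ) ^ 3 / 6 := by
    simp only [Finset.sum_range_succ, Finset.sum_range_zero, Nat.factorial]
    push_cast
    have hI2 : I ^ 2 = -1 := Complex.I_sq
    have hI3 : I ^ 3 = -I := by rw [pow_succ, hI2]; ring
    ring_nf
    rw [hI2, hI3]
    ring
  rw [hsum] at h
  have hn : ‖I * (δ : ℂ)‖ ^ 4 = δ ^ 4 := by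
    rw [norm_mul, Complex.norm_I, one_mul, Complex.norm_real, Real.norm_eq_abs]
    exact Even.pow_abs (by norm_num) δ
  rw [hn] at h
  refine h.trans (le_of_eq ?_)
  norm_num [Nat.factorial]
  ring

/-! ### The recurrence of `liLaguerreOne` -/

/-- **Three-term recurrence** of `u_n = liLaguerreOne n y = L¹_{n−1}(y)` (Szegő (5.1.10) for `α = 1`):
`u_{n+3} + u_{n+1} = (2 − y/(n+2)) u_{n+2}`. -/
theorem liLaguerreOne_rec (y : ℝ) (n : ℕ) :
    liLaguerreOne (n + 3) y + liLaguerreOne (n + 1) y = (2 - y / (n + 2)) * liLaguerreOne (n + 2) y := by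
  rw [PrimeTail.liLaguerreOne_eq_laguerre_eval (n + 3) (by omega),
    PrimeTail.liLaguerreOne_eq_laguerre_eval (n + 1) (by omega),
    PrimeTail.liLaguerreOne_eq_laguerre_eval (n + 2) (by omega)]
  have h := congrArg (fun p : Polynomial ℝ ↦ p.eval y)
    (Literature.Analysis.SpecialFunctions.laguerre_three_term 1 n)
  simp only [Polynomial.eval_mul, Polynomial.eval_sub, Polynomial.eval_C, Polynomial.eval_X] at h
  have hn2 : (n : ℝ) + 2 ≠ 0 := by positivity
  rw [show n + 3 - 1 = n + 2 from rfl, show n + 1 - 1 = n from rfl, show n + 2 - 1 = n + 1 from rfl]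
  field_simp
  linear_combination h

/-! ### The discrete WKB model -/

/-- The phase `φ_n = 2√(ny) + π/4`. -/
def phi (y : ℝ) (n : ℕ) : ℝ := 2 * Real.sqrt (n * y) + Real.pi / 4

/-- The model `z_n = n^{1/4} e^{iφ_n}`. -/
def zm (y : ℝ) (n : ℕ) : ℂ := (qrt n : ℂ) * cexp (I * phi y n)

/-- `‖z_n‖ = n^{1/4}`. -/
theorem norm_zm (y : ℝ) (n : ℕ) : ‖zm y n‖ = qrt n := by
  unfold zm
  rw [norm_mul, Complex.norm_real, Real.norm_eq_abs, abs_of_nonneg (qrt_nonneg _),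
    Literature.Analysis.Fourier.norm_exp_I_mul_ofReal, mul_one]

/-- `Re z_n = n^{1/4} cos φ_n`. -/
theorem zm_re (y : ℝ) (n : ℕ) : (zm y n).re = qrt n * Real.cos (phi y n) := by
  unfold zm
  rw [Complex.re_ofReal_mul, mul_comm I, Complex.exp_ofReal_mul_I_re]

/-- `√(y/n) = √(ny)/n` (`n > 0`). -/
theorem sqrt_div_eq {y : ℝ} (hy : 0 ≤ y) {n : ℝ} (hn : 0 < n) : Real.sqrt (y / n) = Real.sqrt (n * y) / n := by
  rw [eq_div_iff hn.ne', ← Real.sqrt_sq hn.le, ← Real.sqrt_mul (by positivity), Real.sqrt_sq hn.le]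
  congr 1
  field_simp

/-- The phase increment `φ_{n+1} − φ_n = ω(1 + d₊)`, `ω = √(y/n)`, `d₊ = 2(√(1+h) − 1)/h − 1`, `h = 1/n`. -/
theorem phi_succ_sub {y : ℝ} (hy : 0 ≤ y) {n : ℕ} (hn : 1 ≤ n) :
    phi y (n + 1) - phi y n
      = Real.sqrt (y / n) * (1 + (2 * (Real.sqrt (1 + 1 / n) - 1) / (1 / n) - 1)) := by
  have hn0 : (0 : ℝ) < n := by exact_mod_cast hn
  unfold phi
  push_cast
  have e1 : Real.sqrt ((n + 1) * y) = Real.sqrt (n * y) * Real.sqrt (1 + 1 / n) := by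
    rw [← Real.sqrt_mul (by positivity)]; congr 1; field_simp
  rw [e1, sqrt_div_eq hy hn0]
  field_simp
  ring

/-- The phase increment `φ_n − φ_{n−1} = ω(1 + d₋)`, `d₋ = 2(1 − √(1−h))/h − 1` (`n ≥ 2`). -/
theorem phi_sub_pred {y : ℝ} (hy : 0 ≤ y) {n : ℕ} (hn : 2 ≤ n) :
    phi y n - phi y (n - 1)
      = Real.sqrt (y / n) * (1 + (2 * (1 - Real.sqrt (1 - 1 / n)) / (1 / n) - 1)) := by
  have hn0 : (0 : ℝ) < n := by exact_mod_cast (show 0 < n by omega)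
  have hcast : ((n - 1 : ℕ) : ℝ) = (n : ℝ) - 1 := by
    rw [Nat.cast_sub (by omega)]; simp
  unfold phi
  rw [hcast]
  have e1 : Real.sqrt ((n - 1) * y) = Real.sqrt (n * y) * Real.sqrt (1 - 1 / n) := by
    rw [← Real.sqrt_mul (by positivity)]; congr 1; field_simp
  rw [e1, sqrt_div_eq hy hn0]
  field_simp
  ring

/-- The steps in product form: `z_{n+1} = z_n · (1+h)^{1/4} e^{i(φ_{n+1} − φ_n)}`,
`z_{n−1} = z_n · (1−h)^{1/4} e^{−i(φ_n − φ_{n−1})}` (`n ≥ 2`). -/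
theorem zm_steps (y : ℝ) {n : ℕ} (hn : 2 ≤ n) :
    zm y (n + 1) = zm y n * ((qrt (1 + 1 / n) : ℂ) * cexp (I * ((phi y (n + 1) - phi y n : ℝ) : ℂ))) ∧
      zm y (n - 1) = zm y n * ((qrt (1 - 1 / n) : ℂ) * cexp (-(I * ((phi y n - phi y (n - 1) : ℝ) : ℂ)))) := by
  have hn0 : (0 : ℝ) < n := by exact_mod_cast (show 0 < n by omega)
  have hcast : ((n - 1 : ℕ) : ℝ) = (n : ℝ) - 1 := by
    rw [Nat.cast_sub (by omega)]; simp
  constructor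
  · unfold zm
    have hq : qrt ((n + 1 : ℕ) : ℝ) = qrt n * qrt (1 + 1 / n) := by
      rw [← qrt_mul hn0.le]; congr 1; push_cast; field_simp
    rw [hq]
    have e : cexp (I * (phi y (n + 1) : ℂ)) = cexp (I * phi y n) * cexp (I * ((phi y (n + 1) - phi y n : ℝ) : ℂ)) := by
      rw [← Complex.exp_add]; congr 1; push_cast; ring
    rw [e]
    push_cast
    ring
  · unfold zm
    have hq : qrt ((n - 1 : ℕ) : ℝ) = qrt n * qrt (1 - 1 / n) := by
      rw [← qrt_mul hn0.le, hcast]; congr 1; field_simp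
    rw [hq]
    have e : cexp (I * (phi y (n - 1) : ℂ))
        = cexp (I * phi y n) * cexp (-(I * ((phi y n - phi y (n - 1) : ℝ) : ℂ))) := by
      rw [← Complex.exp_add]; congr 1; push_cast; ring
    rw [e]
    push_cast
    ring

end Fejer

end Summit.RiemannHypothesis.RiemannHypothesis.Theorems.LiTheory

end
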